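import Mathlib
import HarnessLib

/-!
# Lovász's greedy covering lemma, with a conflict (disjointness) budget

The greedy covering argument [cite: JuknaBFC2012, Lemma 4.6 (Lovász 1975), pp. 117–118]: if every
point still to be covered is covered by at least a `1/μ` fraction of the available sets, the greedy choice
covers at least a `1/μ` fraction of the remaining points, so after `i` steps at most `|A|·(1 − 1/μ)^i ≤
|A| e^{−i/μ}` points remain ("`b_{i+1} ≤ b_i − b_i/μ`").

We prove the following variant with a CONFLICT relation between the covering objects (supplied here;
needed by cell qa-qnc0, ROUND-30 §3A (E-b), where the objects are coin PAIRS that must be pairwise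
disjoint, and a chosen pair conflicts with the `≤ d` pairs sharing a coin with it):

* objects ("labels") `p ∈ P : Finset α`, points ("rows") `h ∈ H : Finset β`, a decidable relation
  `kills p h`, and a symmetric conflict relation `conf p q`;
* hypotheses: every label conflicts with at most `d` labels of `P` (`hconf`), and every row is killed
  by at least `k` labels of `P` (`hkill`);
* `exists_greedy_cover_le` : for every `m` with `m·d < k`, there is a pairwise non-conflicting
  `A ⊆ P` with `#A ≤ m` leaving at most `#H · (1 − (k − m·d)/#P)^m` rows unkilled;
* `exists_greedy_cover` : if moreover `#H · (1 − (k − m·d)/#P)^m < 1`, such an `A` kills every row.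

The one-step averaging is `exists_label_kills_ge` (some available label kills at least the average).
-/

namespace Literature.Combinatorics.SetFamily.GreedyCover

open Finset

variable {α β : Type*} [DecidableEq α]

omit [DecidableEq α] in
/-- **Averaging step** of the greedy argument: if every row of `Hal` is killed by at least `t` labels of
a non-empty `Pav`, some label of `Pav` kills at least `t·#Hal/#Pav` rows of `Hal` (double counting).
[cite: JuknaBFC2012, Lemma 4.6 (Lovász 1975), proof ("we choose an all-1 submatrix covering the largest number of yet uncovered entries")] -/
theorem exists_label_kills_ge (kills : α → β → Prop) [DecidableRel kills] (Pav : Finset α) (Hal : Finset β)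
    (t : ℕ) (hP : Pav.Nonempty) (ht : ∀ h ∈ Hal, t ≤ (Pav.filter fun p => kills p h).card) :
    ∃ p ∈ Pav, t * Hal.card ≤ (Hal.filter fun h => kills p h).card * Pav.card := by
  -- double counting: Σ_{p ∈ Pav} #{h killed by p} = Σ_{h ∈ Hal} #{p killing h} ≥ t · #Hal
  have hdc : ∑ p ∈ Pav, (Hal.filter fun h => kills p h).card = ∑ h ∈ Hal, (Pav.filter fun p => kills p h).card := by
    simp_rw [card_filter]
    exact sum_comm
  have hsum : t * Hal.card ≤ ∑ p ∈ Pav, (Hal.filter fun h => kills p h).card := by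
    rw [hdc, mul_comm]
    calc Hal.card * t = ∑ _h ∈ Hal, t := by rw [sum_const, smul_eq_mul]
      _ ≤ _ := sum_le_sum ht
  -- the maximum is at least the average
  obtain ⟨p, hp, hmax⟩ := exists_max_image Pav (fun p => (Hal.filter fun h => kills p h).card) hP
  refine ⟨p, hp, hsum.trans ?_⟩
  calc ∑ q ∈ Pav, (Hal.filter fun h => kills q h).card
      ≤ ∑ _q ∈ Pav, (Hal.filter fun h => kills p h).card := sum_le_sum fun q hq => hmax q hq
    _ = (Hal.filter fun h => kills p h).card * Pav.card := by rw [sum_const, smul_eq_mul, mul_comm]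

/-- The greedy induction with a conflict budget (generalised over the available labels `Pav ⊆ P`, the
alive rows `Hal`, and the number `j` of steps already taken: every alive row keeps `≥ k − j·d` killers).
[cite: JuknaBFC2012, Lemma 4.6 (Lovász 1975), proof; conflict-budget bookkeeping supplied here] -/
theorem greedy_aux (P : Finset α) (kills : α → β → Prop) [DecidableRel kills] (conf : α → α → Prop)
    [DecidableRel conf] (hsymm : ∀ p q, conf p q → conf q p) (d k m : ℕ) (hmd : m * d < k)
    (hconf : ∀ p ∈ P, (P.filter fun q => conf p q).card ≤ d)
    (hkP : k ≤ P.card) :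
    ∀ (n j : ℕ) (Pav : Finset α) (Hal : Finset β), j + n ≤ m → Pav ⊆ P →
      (∀ h ∈ Hal, k - j * d ≤ (Pav.filter fun p => kills p h).card) →
      ∃ A : Finset α, A ⊆ Pav ∧ A.card ≤ n ∧ (∀ p ∈ A, ∀ q ∈ A, p ≠ q → ¬ conf p q) ∧
        (((Hal.filter fun h => ∀ p ∈ A, ¬ kills p h).card : ℝ) ≤
          Hal.card * (1 - ((k - m * d : ℕ) : ℝ) / P.card) ^ n) := by
  intro n
  induction n with
  | zero =>
    intro j Pav Hal _ _ _
    refine ⟨∅, empty_subset _, le_rfl, by simp, ?_⟩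
    simp only [notMem_empty, IsEmpty.forall_iff, implies_true, filter_true_of_mem, pow_zero, mul_one, le_refl]
  | succ n ih =>
    intro j Pav Hal hjn hPav hk
    -- the decay factor θ = (k - m d)/#P lies in [0, 1]
    set θ : ℝ := ((k - m * d : ℕ) : ℝ) / P.card with hθ
    have hθ0 : 0 ≤ θ := by rw [hθ]; positivity
    have hθ1 : θ ≤ 1 := by
      rw [hθ]
      rcases Nat.eq_zero_or_pos P.card with h0 | hpos
      · rw [h0]; simp
      · rw [div_le_one (by exact_mod_cast hpos)]
        exact_mod_cast (Nat.sub_le k (m * d)).trans hkP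
    by_cases hHal : Hal = ∅
    · refine ⟨∅, empty_subset _, Nat.zero_le _, by simp, ?_⟩
      rw [hHal]; simp
    -- alive rows exist, hence available killers exist
    obtain ⟨h₀, hh₀⟩ := nonempty_iff_ne_empty.2 hHal
    have hkj : 1 ≤ k - j * d := by
      have : j * d ≤ m * d := Nat.mul_le_mul_right d (by omega)
      omega
    have hPne : Pav.Nonempty := by
      have h1 : 1 ≤ (Pav.filter fun p => kills p h₀).card := hkj.trans (hk h₀ hh₀)
      obtain ⟨p, hp⟩ := card_pos.1 (Nat.lt_of_lt_of_le Nat.zero_lt_one h1)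
      exact ⟨p, (mem_filter.1 hp).1⟩
    -- greedy choice
    obtain ⟨p, hp, havg⟩ := exists_label_kills_ge kills Pav Hal (k - j * d) hPne hk
    set Hal' := Hal.filter fun h => ¬ kills p h with hHal'
    set Pav' := Pav.filter fun q => ¬ conf p q with hPav'
    -- alive rows keep ≥ k - (j+1) d killers among the non-conflicting labels
    have hk' : ∀ h ∈ Hal', k - (j + 1) * d ≤ (Pav'.filter fun q => kills q h).card := by
      intro h hh
      have hh1 : h ∈ Hal := (mem_filter.1 hh).1
      have hsplit := card_filter_add_card_filter_not (s := Pav.filter fun q => kills q h) (fun q => ¬ conf p q)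
      have hconf' : ((Pav.filter fun q => kills q h).filter fun q => ¬ ¬ conf p q).card ≤ d := by
        refine le_trans (card_le_card ?_) (hconf p (hPav hp))
        intro q hq
        simp only [mem_filter, not_not] at hq
        exact mem_filter.2 ⟨hPav hq.1.1, hq.2⟩
      have heq : ((Pav.filter fun q => kills q h).filter fun q => ¬ conf p q) = (Pav'.filter fun q => kills q h) := by
        rw [hPav', filter_filter, filter_filter]
        exact filter_congr fun q _ => and_comm
      rw [← heq]
      have := hk h hh1
      rw [Nat.add_mul, Nat.one_mul]
      omega
    -- the killed fraction is at least θ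
    have hcardHal' : (Hal'.card : ℝ) ≤ Hal.card * (1 - θ) := by
      have hsplit := card_filter_add_card_filter_not (s := Hal) (fun h => kills p h)
      have hPavP : (Pav.card : ℝ) ≤ P.card := by exact_mod_cast card_le_card hPav
      have hPpos : (0 : ℝ) < Pav.card := by exact_mod_cast hPne.card_pos
      -- #killed ≥ (k - j d) #Hal / #Pav ≥ θ #Hal
      have h1 : ((k - j * d : ℕ) : ℝ) * Hal.card ≤ ((Hal.filter fun h => kills p h).card : ℝ) * Pav.card := by
        exact_mod_cast havg
      have h2 : ((k - m * d : ℕ) : ℝ) ≤ ((k - j * d : ℕ) : ℝ) := by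
        have : j * d ≤ m * d := Nat.mul_le_mul_right d (by omega)
        exact_mod_cast Nat.sub_le_sub_left this k
      have h3 : θ * Hal.card ≤ ((Hal.filter fun h => kills p h).card : ℝ) := by
        rw [hθ]
        rcases Nat.eq_zero_or_pos P.card with h0 | hpos
        · rw [h0]; simp
        · have hPpos' : (0 : ℝ) < P.card := by exact_mod_cast hpos
          rw [div_mul_eq_mul_div, div_le_iff₀ hPpos']
          calc ((k - m * d : ℕ) : ℝ) * Hal.card ≤ ((k - j * d : ℕ) : ℝ) * Hal.card :=
                mul_le_mul_of_nonneg_right h2 (Nat.cast_nonneg _)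
            _ ≤ ((Hal.filter fun h => kills p h).card : ℝ) * Pav.card := h1
            _ ≤ ((Hal.filter fun h => kills p h).card : ℝ) * P.card :=
                mul_le_mul_of_nonneg_left hPavP (Nat.cast_nonneg _)
      have h4 : (Hal'.card : ℝ) = Hal.card - ((Hal.filter fun h => kills p h).card : ℝ) := by
        rw [hHal']
        have := congrArg (fun n : ℕ => (n : ℝ)) hsplit
        push_cast at this
        linarith
      rw [h4]
      nlinarith
    -- recurse
    obtain ⟨A', hA'sub, hA'card, hA'conf, hA'rest⟩ :=
      ih (j + 1) Pav' Hal' (by omega) ((filter_subset _ _).trans hPav) hk'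
    refine ⟨insert p A', ?_, ?_, ?_, ?_⟩
    · exact insert_subset hp (hA'sub.trans (filter_subset _ _))
    · exact (card_insert_le p A').trans (by omega)
    · intro q hq r hr hqr
      rcases mem_insert.1 hq with rfl | hqA'
      · rcases mem_insert.1 hr with rfl | hrA'
        · exact absurd rfl hqr
        · exact (mem_filter.1 (hA'sub hrA')).2
      · rcases mem_insert.1 hr with rfl | hrA'
        · exact fun hc => (mem_filter.1 (hA'sub hqA')).2 (hsymm _ _ hc)
        · exact hA'conf q hqA' r hrA' hqr
    · -- rows unkilled by insert p A' = rows of Hal' unkilled by A'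
      have heq : (Hal.filter fun h => ∀ q ∈ insert p A', ¬ kills q h) =
          (Hal'.filter fun h => ∀ q ∈ A', ¬ kills q h) := by
        rw [hHal', filter_filter]
        refine filter_congr fun h _ => ?_
        simp only [mem_insert, forall_eq_or_imp]
      rw [heq]
      calc ((Hal'.filter fun h => ∀ q ∈ A', ¬ kills q h).card : ℝ)
          ≤ Hal'.card * (1 - θ) ^ n := hA'rest
        _ ≤ Hal.card * (1 - θ) * (1 - θ) ^ n :=
            mul_le_mul_of_nonneg_right hcardHal' (pow_nonneg (by linarith) n)
        _ = Hal.card * (1 - θ) ^ (n + 1) := by ring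

/-- **Greedy covering with a conflict budget (quantitative form).**  If every label conflicts with at
most `d` labels and every row has more than `m·d` killers (`k > m·d`), then some pairwise non-conflicting set of
at most `m` labels leaves at most `#H·(1 − (k − m·d)/#P)^m` rows unkilled.
[cite: JuknaBFC2012, Lemma 4.6 (Lovász 1975), pp. 117–118; conflict-budget variant supplied here] -/
theorem exists_greedy_cover_le (P : Finset α) (H : Finset β) (kills : α → β → Prop) [DecidableRel kills]
    (conf : α → α → Prop) [DecidableRel conf] (hsymm : ∀ p q, conf p q → conf q p) (d k m : ℕ) (hmd : m * d < k)
    (hconf : ∀ p ∈ P, (P.filter fun q => conf p q).card ≤ d)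
    (hkill : ∀ h ∈ H, k ≤ (P.filter fun p => kills p h).card) :
    ∃ A : Finset α, A ⊆ P ∧ A.card ≤ m ∧ (∀ p ∈ A, ∀ q ∈ A, p ≠ q → ¬ conf p q) ∧
      (((H.filter fun h => ∀ p ∈ A, ¬ kills p h).card : ℝ) ≤
        H.card * (1 - ((k - m * d : ℕ) : ℝ) / P.card) ^ m) := by
  by_cases hH : H = ∅
  · refine ⟨∅, empty_subset _, Nat.zero_le _, by simp, ?_⟩
    rw [hH]; simp
  obtain ⟨h₀, hh₀⟩ := nonempty_iff_ne_empty.2 hH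
  have hkP : k ≤ P.card := (hkill h₀ hh₀).trans (card_le_card (filter_subset _ _))
  have := greedy_aux P kills conf hsymm d k m hmd hconf hkP m 0 P H (by omega) (Subset.refl _)
    (fun h hh => by simpa using hkill h hh)
  exact this

/-- **Greedy covering with a conflict budget.**  Under the hypotheses of `exists_greedy_cover_le`, if
`#H·(1 − (k − m·d)/#P)^m < 1` then some pairwise non-conflicting set of at most `m` labels kills every
row.  (With `d = 0` and `m = ⌈μ ln #H⌉ + 1`, `k = #P/μ`, this is Lovász's bound `Cov ≤ μ ln|A| + 1`.)
[cite: JuknaBFC2012, Lemma 4.6 (Lovász 1975), pp. 117–118; conflict-budget variant supplied here] -/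
theorem exists_greedy_cover (P : Finset α) (H : Finset β) (kills : α → β → Prop) [DecidableRel kills]
    (conf : α → α → Prop) [DecidableRel conf] (hsymm : ∀ p q, conf p q → conf q p) (d k m : ℕ) (hmd : m * d < k)
    (hconf : ∀ p ∈ P, (P.filter fun q => conf p q).card ≤ d)
    (hkill : ∀ h ∈ H, k ≤ (P.filter fun p => kills p h).card)
    (hsmall : (H.card : ℝ) * (1 - ((k - m * d : ℕ) : ℝ) / P.card) ^ m < 1) :
    ∃ A : Finset α, A ⊆ P ∧ A.card ≤ m ∧ (∀ p ∈ A, ∀ q ∈ A, p ≠ q → ¬ conf p q) ∧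
      ∀ h ∈ H, ∃ p ∈ A, kills p h := by
  obtain ⟨A, hAP, hAm, hAconf, hrest⟩ := exists_greedy_cover_le P H kills conf hsymm d k m hmd hconf hkill
  refine ⟨A, hAP, hAm, hAconf, fun h hh => ?_⟩
  by_contra hno
  push Not at hno
  have hmem : h ∈ H.filter fun h => ∀ p ∈ A, ¬ kills p h := mem_filter.2 ⟨hh, hno⟩
  have h1 : (1 : ℝ) ≤ ((H.filter fun h => ∀ p ∈ A, ¬ kills p h).card : ℝ) := by
    exact_mod_cast card_pos.2 ⟨h, hmem⟩
  linarith

end Literature.Combinatorics.SetFamily.GreedyCover
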